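import Summits.QuantumFields.YangMills.Theorems.InfiniteVolumeShiftDefect
import Summits.QuantumFields.YangMills.Theorems.BalabanLadderInfVolCeilingsDefs
import HarnessLib

/-!
# Infinite volume by compactness, class-parametric form VI: centre-smeared and base-point-smeared functionals have
# the same limits along ANY family of probability states with volume-free ceilings

HONEST FRAMING (cell `ym-fleet`, seat `ym-infvol-p2`, director-ym R136 (i); count-neutral helper for the route owner's
ruling on the «torus parity» junction (ym-beyond-p2 g20 2026-08-26T18:17:23Z, (c′)∕(E)); companion of
`InfiniteVolumeMomentBoundsOnSides`, `InfiniteVolumeContinuumDataOn`).  Pure soft analysis, kernel-checked.  The ceilings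
`MomentBounds6On G r a 𝓢` (p1's volume-free predicate) are a HYPOTHESIS (owed E0′); NOTHING is asserted about Yang–Mills,
rotations, reflection positivity, a mass gap, or Clay.

WHAT IS PROVED ([folklore]) — the seat's step 11 (`InfiniteVolumeCentreBase`) with the state family abstract: g0's
proof used `μ_k ∈ oddTorusLimitPoints r (β_k)` only through the `ℤ⁴`-collar bound of the weights and the probability
normalisation; here both are hypotheses (`MomentBounds6On G r a 𝓢`, probability states `μ_k ∈ 𝓢 (β_k)`):
* `tendsto_tsum_shift_sub_base_on` — the O(a) shift defect for offsets `‖c k l‖ ≤ a(β_k)` along thresholds-satisfying data;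
* `tendsto_centre_sub_base_zero_on`, **`tendsto_base_of_tendsto_centre_on`**, **`tendsto_centre_of_tendsto_base_on`**,
  `tendsto_centre_iff_base_on` — along ANY `β_k → ∞` (thresholds eventually, index shift inside) the plaquette-CENTRE
  and BASE-point smearings of the infinite-volume plane-string series have the same limits on `⁰𝒮ₙ`.
Use: converts the DATA clause of the class package (`exists_ivDataOn_onSides`, centre smearing) to base points, the form
p1's `Q2State`∕`Q3State` dictionary and the torus junction consume.

References: J. Glimm, A. Jaffe, Quantum Physics (1987) §6.1; K. Osterwalder, R. Schrader, CMP 42 (1975) §4.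
-/

set_option autoImplicit false

noncomputable section

open scoped BigOperators SchwartzMap
open MeasureTheory Filter Topology
open Literature.MathematicalPhysics.QuantumFieldTheory hiding ZdEdge
open Literature.MathematicalPhysics.QuantumLattice
open Literature.MathematicalPhysics.AQFT
open Literature.Probability.LatticeModels (box Site)
open Summit.QuantumFields.YangMills.Cruxes.OSLegsFromFemtoAndGap.DlrCollarTransfer (plane exists_abs_plane_le)

namespace Summit.QuantumFields.YangMills.Theorems.InfiniteVolume

variable {G : Type} [Group G] [TopologicalSpace G] [IsTopologicalGroup G] [CompactSpace G]
  [MeasurableSpace G] [BorelSpace G]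

omit [BorelSpace G] in
/-- **The O(a) shift defect along a family of probability states with the `ℤ⁴`-collar bound** (state-family-abstract
twin of `tendsto_tsum_shift_sub_base`): `0 < a(β_k) ≤ 1/24`, `a(β_k) ≤ ℓ₄`, `a(β_k) → 0`, weights `stateMomentStr` with
`|·| ≤ (C/R⁴)ⁿ` at `R·a(β_k) ≤ ℓ₄` and `ℤ⁴`-separation `2R+4`, offsets `‖c k l‖ ≤ a(β_k)`, `n ≥ 2`, valid `q`, `F ∈ ⁰𝒮ₙ`:
the centre-type series minus the base-point series tends to `0`. [folklore] -/
theorem tendsto_tsum_shift_sub_base_on (r : LatticeRep G) {a : ℝ → ℝ} {C ℓ₄ : ℝ} (hℓ : 0 < ℓ₄) (hC : 0 ≤ C)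
    (β : ℕ → ℝ) (ha : ∀ k, 0 < a (β k)) (ha24 : ∀ k, a (β k) ≤ 1 / 24) (haℓ : ∀ k, a (β k) ≤ ℓ₄)
    (ha0 : Tendsto (fun k => a (β k)) atTop (𝓝 0))
    (μ : ℕ → Measure (LGConfig 4 G)) [∀ k, IsProbabilityMeasure (μ k)]
    (hcol : ∀ (k n : ℕ) (q : Fin n → Fin 4 × Fin 4) (x : Fin n → Site 4) (R : ℕ), (∀ i, (q i).1 < (q i).2) →
      1 ≤ R → (R : ℝ) * a (β k) ≤ ℓ₄ →
      (∀ i j : Fin n, i ≠ j → ∃ m : Fin 4, (2 * (R : ℤ) + 4) ≤ |x i m - x j m|) →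
      |stateMomentStr G r (μ k) n q x| ≤ (C / (R : ℝ) ^ 4) ^ n)
    {n : ℕ} (hn : 2 ≤ n) (q : Fin n → Fin 4 × Fin 4) (hq : ∀ i, (q i).1 < (q i).2)
    (c : ℕ → Fin n → EuclideanSpace ℝ (Fin 4)) (hc : ∀ k l, ‖c k l‖ ≤ a (β k))
    (F : 𝓢((Fin n → EuclideanSpace ℝ (Fin 4)), ℂ)) (hF : IsOffDiagonal F) :
    Tendsto (fun k => ∑' x : Fin n → Site 4, ((stateMomentStr G r (μ k) n q x : ℝ) : ℂ) *
          F (fun l => a (β k) • siteToE (x l) + c k l) -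
      ∑' x : Fin n → Site 4, ((stateMomentStr G r (μ k) n q x : ℝ) : ℂ) * F (fun l => a (β k) • siteToE (x l)))
      atTop (𝓝 0) := by
  obtain ⟨Cp, hCp⟩ := exists_abs_plane_le (G := G) r
  have hCp0 : 0 ≤ Cp := le_trans (abs_nonneg _) (hCp (0, 1) 0 (fun _ => 1))
  have ha1 : ∀ k, a (β k) ≤ 1 := fun k => (ha24 k).trans (by norm_num)
  set KK : ℝ := (((Cp + Cp) * 4 ^ 4 * 5 ^ 6 + (Cp + Cp) * 2 ^ 6 * (10 + 2 * (0 + 1)) ^ 4 +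
      16 * C * 2 ^ 6 * (2 / ℓ₄ + 48) ^ 4) * 2 ^ 6 * (81 * ∑' m : ℕ, (((m : ℝ) + 1) ^ 2)⁻¹)) ^ n with hKK
  have hKK0 : 0 ≤ KK := by
    have : 0 ≤ ∑' m : ℕ, (((m : ℝ) + 1) ^ 2)⁻¹ := tsum_nonneg fun m => by positivity
    positivity
  -- the shift defect at level `k` is at most `2 ‖c k‖ KK (5 ‖F‖)`
  have hdef : ∀ k, ‖∑' x : Fin n → Site 4, ((stateMomentStr G r (μ k) n q x : ℝ) : ℂ) *
          F (fun l => a (β k) • siteToE (x l) + c k l) -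
      ∑' x : Fin n → Site 4, ((stateMomentStr G r (μ k) n q x : ℝ) : ℂ) *
          F (fun l => a (β k) • siteToE (x l))‖ ≤ 2 * ‖c k‖ * KK * (5 * schwartzNorm (10 * n + 1) F) := by
    intro k
    have h := norm_tsum_weight_shift_sub_le_of_zdCollar (s₁ := 0) (s₂ := 1) hℓ hC
      (by positivity : 0 ≤ Cp + Cp)
      (fun x => stateMomentStr G r (μ k) n q x)
      (fun x => abs_infVolWeight_le r hCp (μ k) q x)
      (fun x R hR hRa hsep => hcol k n q x R hq hR hRa hsep)
      (ha k) (ha1 k) (haℓ k) hn le_rfl zero_le_one (by norm_num) (by linarith [ha24 k]) F hF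
      (fun x l => a (β k) • siteToE (x l)) (fun x l => by simp) (c k) (fun l => by rw [one_mul]; exact hc k l)
    have heq : ∀ x : Fin n → Site 4, ((fun l => a (β k) • siteToE (x l)) + c k) =
        fun l => a (β k) • siteToE (x l) + c k l := fun x => by
      funext l; simp only [Pi.add_apply]
    simp only [heq] at h
    exact h
  -- `‖c k‖ ≤ a (β k) → 0`
  have hck : ∀ k, ‖c k‖ ≤ a (β k) := fun k => by
    refine (pi_norm_le_iff_of_nonneg (ha k).le).2 fun l => hc k l
  rw [NormedAddGroup.tendsto_nhds_zero]
  intro ε hε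
  have hlim : Tendsto (fun k => 2 * a (β k) * KK * (5 * schwartzNorm (10 * n + 1) F)) atTop (𝓝 0) := by
    have := ((ha0.const_mul 2).mul_const KK).mul_const (5 * schwartzNorm (10 * n + 1) F)
    simpa using this
  filter_upwards [(NormedAddGroup.tendsto_nhds_zero.1 hlim) ε hε] with k hk
  have hnn : 0 ≤ 2 * a (β k) * KK * (5 * schwartzNorm (10 * n + 1) F) := by
    have := schwartzNorm_nonneg (10 * n + 1) F
    have := (ha k).le
    positivity
  rw [Real.norm_of_nonneg hnn] at hk
  calc _ ≤ 2 * ‖c k‖ * KK * (5 * schwartzNorm (10 * n + 1) F) := hdef k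
    _ ≤ 2 * a (β k) * KK * (5 * schwartzNorm (10 * n + 1) F) := by
        have := schwartzNorm_nonneg (10 * n + 1) F
        gcongr
        exact hck k
    _ < ε := hk

omit [BorelSpace G] in
/-- **Centre minus base `→ 0` along ANY data of a state family with volume-free ceilings.**  `MomentBounds6On G r a 𝓢`,
probability states `μ_k ∈ 𝓢 (β_k)`, `β_k → ∞`, `a > 0`, `a → 0` (thresholds eventually: index shift inside), `n ≥ 2`,
valid `q`, `F ∈ ⁰𝒮ₙ`. [folklore] -/
theorem tendsto_centre_sub_base_zero_on (r : LatticeRep G) {a : ℝ → ℝ} (hapos : ∀ β, 0 < a β)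
    (ha0 : Tendsto a atTop (𝓝 0)) {𝓢 : ℝ → Set (Measure (LGConfig 4 G))} (hMB : MomentBounds6On G r a 𝓢)
    (β : ℕ → ℝ) (hβ : Tendsto β atTop atTop) (μ : ℕ → Measure (LGConfig 4 G)) [∀ k, IsProbabilityMeasure (μ k)]
    (hμ : ∀ k, μ k ∈ 𝓢 (β k)) {n : ℕ} (hn : 2 ≤ n) (q : Fin n → Fin 4 × Fin 4) (hq : ∀ i, (q i).1 < (q i).2)
    (F : 𝓢((Fin n → EuclideanSpace ℝ (Fin 4)), ℂ)) (hF : IsOffDiagonal F) :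
    Tendsto (fun k => ∑' x : Fin n → (Fin 4 → ℤ), ((stateMomentStr G r (μ k) n q x : ℝ) : ℂ) *
        F (fun l => a (β k) • siteToE (x l) +
          (a (β k) / 2) • (EuclideanSpace.single (q l).1 (1 : ℝ) + EuclideanSpace.single (q l).2 (1 : ℝ))) -
      ∑' x : Fin n → (Fin 4 → ℤ), ((stateMomentStr G r (μ k) n q x : ℝ) : ℂ) * F (fun l => a (β k) • siteToE (x l)))
      atTop (𝓝 0) := by
  obtain ⟨C, β₄, ℓ₄, hℓ, hC, Hcol⟩ := hMB
  -- thresholds hold from some index `k₀` on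
  obtain ⟨B₁, hB₁⟩ : ∃ B₁ : ℝ, ∀ b, B₁ ≤ b → a b < min (1 / 24) ℓ₄ :=
    Filter.eventually_atTop.1 (ha0.eventually (gt_mem_nhds (by positivity)))
  obtain ⟨k₀, hk₀⟩ := Filter.eventually_atTop.1 (hβ.eventually (eventually_ge_atTop (max β₄ B₁)))
  have hβ' : ∀ k, β₄ ≤ β (k + k₀) := fun k => le_trans (le_max_left _ _) (hk₀ _ (Nat.le_add_left _ _))
  have hB' : ∀ k, B₁ ≤ β (k + k₀) := fun k => le_trans (le_max_right _ _) (hk₀ _ (Nat.le_add_left _ _))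
  have ha' : ∀ k, 0 < a (β (k + k₀)) := fun k => hapos _
  have ha24' : ∀ k, a (β (k + k₀)) ≤ 1 / 24 := fun k => (hB₁ _ (hB' k)).le.trans (min_le_left _ _)
  have haℓ' : ∀ k, a (β (k + k₀)) ≤ ℓ₄ := fun k => (hB₁ _ (hB' k)).le.trans (min_le_right _ _)
  have ha0' : Tendsto (fun k => a (β (k + k₀))) atTop (𝓝 0) :=
    (ha0.comp hβ).comp (tendsto_add_atTop_nat k₀)
  have hc : ∀ (k : ℕ) (l : Fin n), ‖(a (β (k + k₀)) / 2) •
      (EuclideanSpace.single (q l).1 (1 : ℝ) + EuclideanSpace.single (q l).2 (1 : ℝ))‖ ≤ a (β (k + k₀)) :=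
    fun k l => by
      rw [norm_smul, Real.norm_of_nonneg (by linarith [(ha' k).le] : (0 : ℝ) ≤ a (β (k + k₀)) / 2)]
      have h1 : ‖EuclideanSpace.single (q l).1 (1 : ℝ) + EuclideanSpace.single (q l).2 (1 : ℝ)‖ ≤ 2 := by
        have e1 : ‖EuclideanSpace.single (q l).1 (1 : ℝ)‖ = 1 := by
          rw [show EuclideanSpace.single (q l).1 (1 : ℝ) = PiLp.single 2 (q l).1 (1 : ℝ) from rfl,
            PiLp.norm_single 2 (fun _ : Fin 4 => ℝ) (q l).1 (1 : ℝ), norm_one]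
        have e2 : ‖EuclideanSpace.single (q l).2 (1 : ℝ)‖ = 1 := by
          rw [show EuclideanSpace.single (q l).2 (1 : ℝ) = PiLp.single 2 (q l).2 (1 : ℝ) from rfl,
            PiLp.norm_single 2 (fun _ : Fin 4 => ℝ) (q l).2 (1 : ℝ), norm_one]
        calc _ ≤ ‖EuclideanSpace.single (q l).1 (1 : ℝ)‖ + ‖EuclideanSpace.single (q l).2 (1 : ℝ)‖ :=
              norm_add_le _ _
          _ = 2 := by rw [e1, e2]; norm_num
      nlinarith [(ha' k).le]
  haveI : ∀ k, IsProbabilityMeasure ((fun k => μ (k + k₀)) k) := fun k => inferInstance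
  have h := tendsto_tsum_shift_sub_base_on r hℓ hC (fun k => β (k + k₀)) ha' ha24' haℓ' ha0'
    (fun k => μ (k + k₀))
    (fun k n' q' x R hq' hR hRa hsep => Hcol (β (k + k₀)) (hβ' k) (μ (k + k₀)) (hμ _) n' q' x R hq' hR hRa hsep)
    hn q hq
    (fun k l => (a (β (k + k₀)) / 2) • (EuclideanSpace.single (q l).1 (1 : ℝ) + EuclideanSpace.single (q l).2 (1 : ℝ)))
    hc F hF
  -- unshift the index
  rw [← tendsto_add_atTop_iff_nat k₀]
  exact h

omit [BorelSpace G] in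
/-- **Base-point convergence from centre convergence, state family abstract.** [folklore] -/
theorem tendsto_base_of_tendsto_centre_on (r : LatticeRep G) {a : ℝ → ℝ} (hapos : ∀ β, 0 < a β)
    (ha0 : Tendsto a atTop (𝓝 0)) {𝓢 : ℝ → Set (Measure (LGConfig 4 G))} (hMB : MomentBounds6On G r a 𝓢)
    (β : ℕ → ℝ) (hβ : Tendsto β atTop atTop) (μ : ℕ → Measure (LGConfig 4 G)) [∀ k, IsProbabilityMeasure (μ k)]
    (hμ : ∀ k, μ k ∈ 𝓢 (β k)) {n : ℕ} (hn : 2 ≤ n) (q : Fin n → Fin 4 × Fin 4) (hq : ∀ i, (q i).1 < (q i).2)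
    (F : 𝓢((Fin n → EuclideanSpace ℝ (Fin 4)), ℂ)) (hF : IsOffDiagonal F) {z : ℂ}
    (h : Tendsto (fun k => ∑' x : Fin n → (Fin 4 → ℤ), ((stateMomentStr G r (μ k) n q x : ℝ) : ℂ) *
        F (fun l => a (β k) • siteToE (x l) +
          (a (β k) / 2) • (EuclideanSpace.single (q l).1 (1 : ℝ) + EuclideanSpace.single (q l).2 (1 : ℝ))))
        atTop (𝓝 z)) :
    Tendsto (fun k => ∑' x : Fin n → (Fin 4 → ℤ), ((stateMomentStr G r (μ k) n q x : ℝ) : ℂ) *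
        F (fun l => a (β k) • siteToE (x l))) atTop (𝓝 z) := by
  have hd := tendsto_centre_sub_base_zero_on r hapos ha0 hMB β hβ μ hμ hn q hq F hF
  have h2 := h.sub hd
  rw [sub_zero] at h2
  refine h2.congr fun k => ?_
  simp only [sub_sub_cancel]

omit [BorelSpace G] in
/-- **Centre convergence from base-point convergence, state family abstract.** [folklore] -/
theorem tendsto_centre_of_tendsto_base_on (r : LatticeRep G) {a : ℝ → ℝ} (hapos : ∀ β, 0 < a β)
    (ha0 : Tendsto a atTop (𝓝 0)) {𝓢 : ℝ → Set (Measure (LGConfig 4 G))} (hMB : MomentBounds6On G r a 𝓢)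
    (β : ℕ → ℝ) (hβ : Tendsto β atTop atTop) (μ : ℕ → Measure (LGConfig 4 G)) [∀ k, IsProbabilityMeasure (μ k)]
    (hμ : ∀ k, μ k ∈ 𝓢 (β k)) {n : ℕ} (hn : 2 ≤ n) (q : Fin n → Fin 4 × Fin 4) (hq : ∀ i, (q i).1 < (q i).2)
    (F : 𝓢((Fin n → EuclideanSpace ℝ (Fin 4)), ℂ)) (hF : IsOffDiagonal F) {z : ℂ}
    (h : Tendsto (fun k => ∑' x : Fin n → (Fin 4 → ℤ), ((stateMomentStr G r (μ k) n q x : ℝ) : ℂ) *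
        F (fun l => a (β k) • siteToE (x l))) atTop (𝓝 z)) :
    Tendsto (fun k => ∑' x : Fin n → (Fin 4 → ℤ), ((stateMomentStr G r (μ k) n q x : ℝ) : ℂ) *
        F (fun l => a (β k) • siteToE (x l) +
          (a (β k) / 2) • (EuclideanSpace.single (q l).1 (1 : ℝ) + EuclideanSpace.single (q l).2 (1 : ℝ))))
        atTop (𝓝 z) := by
  have hd := tendsto_centre_sub_base_zero_on r hapos ha0 hMB β hβ μ hμ hn q hq F hF
  have h2 := hd.add h
  rw [zero_add] at h2
  refine h2.congr fun k => ?_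
  simp only [sub_add_cancel]

omit [BorelSpace G] in
/-- **The two smearings have the same limits, state family abstract.** [folklore] -/
theorem tendsto_centre_iff_base_on (r : LatticeRep G) {a : ℝ → ℝ} (hapos : ∀ β, 0 < a β)
    (ha0 : Tendsto a atTop (𝓝 0)) {𝓢 : ℝ → Set (Measure (LGConfig 4 G))} (hMB : MomentBounds6On G r a 𝓢)
    (β : ℕ → ℝ) (hβ : Tendsto β atTop atTop) (μ : ℕ → Measure (LGConfig 4 G)) [∀ k, IsProbabilityMeasure (μ k)]
    (hμ : ∀ k, μ k ∈ 𝓢 (β k)) {n : ℕ} (hn : 2 ≤ n) (q : Fin n → Fin 4 × Fin 4) (hq : ∀ i, (q i).1 < (q i).2)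
    (F : 𝓢((Fin n → EuclideanSpace ℝ (Fin 4)), ℂ)) (hF : IsOffDiagonal F) (z : ℂ) :
    Tendsto (fun k => ∑' x : Fin n → (Fin 4 → ℤ), ((stateMomentStr G r (μ k) n q x : ℝ) : ℂ) *
        F (fun l => a (β k) • siteToE (x l) +
          (a (β k) / 2) • (EuclideanSpace.single (q l).1 (1 : ℝ) + EuclideanSpace.single (q l).2 (1 : ℝ))))
        atTop (𝓝 z) ↔
      Tendsto (fun k => ∑' x : Fin n → (Fin 4 → ℤ), ((stateMomentStr G r (μ k) n q x : ℝ) : ℂ) *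
        F (fun l => a (β k) • siteToE (x l))) atTop (𝓝 z) :=
  ⟨tendsto_base_of_tendsto_centre_on r hapos ha0 hMB β hβ μ hμ hn q hq F hF,
    tendsto_centre_of_tendsto_base_on r hapos ha0 hMB β hβ μ hμ hn q hq F hF⟩

end Summit.QuantumFields.YangMills.Theorems.InfiniteVolume

end
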